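import Literature.AnabelianGeometry.SemiGraphs.SectionDoubleSheets
import HarnessLib

/-!
# Sheets of a section of the reglued double along walks of `𝔾_A`: no section across a non-separating cell
# ([SemiAnbd] §2, Def. 2.2 (i) p. 23, proof of Cor. 2.7 (i) p. 30)

Mochizuki, *Semi-graphs of anabelioids*, Publ. RIMS **42** (2006) 221–322, §2: Def. 2.2 (i) p. 23 (the
semi-graph `𝔾_A` of the covering attached to `A`: vertices the components of the `S_v`, edges the components
of the `T_e`, the branch `(b, Q)` abutting to `(v, P)` when `Q` lies under `P` via `ψ_b`), proof of Cor. 2.7 (i)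
p. 30 (the sheets `ℋ″`, `g·ℋ″` of a two-sheeted situation) [cite: MochizukiSemiAnbd2006, Cor. 2.7(i) p.30].

abc-iut cell, layer L3, FACT-LIST row F-1487 (`covering_subgraphComponents_doubleCosets` AS TYPED), CLASS route
«regluing invisibility» of abc-iut-w4-d080 (`HOME/staging/w4/w4-d080-g7/F1487-MASSBALANCE-MEMO.md` §5/§9, GAP row
G-w4d080-g7-1), brick **(R5e-WALK)** = the successor row «F1487-R5e-WALK»; seat abc-iut-L3-d2 (gen 9), L3-lead
δ20 (iii).  PROOF-ONLY (no definitions, no instances, no new named fact).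

For an object `A` of `B(𝒢)`, a branch-cell `bc₀ = (b₀, Q)` of `𝔾_A := A.fibreData.total` and the double
`A ⊔ A` reglued along abc-iut-w4-d080's detection twist `θ := A.doubleTwist b₀ Q` (component swap over `Q`
at `b₀`, identity elsewhere; `SectionDoubleReglue.lean`), a SECTION `σ : A → (A ⊔ A)^θ` of the reglued
codiagonal paints every cell of `𝔾_A` with one of two sheets (`SectionDoubleSheets.lean`:
`sheet_dichotomy_S/T`, `sheet_exclusive_S/T`).  This file runs the paint along WALKS of `𝔾_A`:

* `eq_of_branchMap_eq_of_heq_brComp` — bookkeeping: a branch-cell is determined by its branch and its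
  component;
* `sheet_transfer_total` — along every incidence `bc ≠ bc₀` of `𝔾_A` (branch-cell `bc` abutting to the
  vertex-cell `vc`) the edge-cell of `bc` has the sheet of `vc` (`BObj.sheet_transfer`);
* `sheet_flip_total` — along `bc₀` itself the sheet FLIPS (`BObj.sheet_flip`);
* `sheetS_iff_of_reflTransGen` — hence the vertex sheet is constant along every chain of incidences of
  `𝔾_A` avoiding `bc₀` (induction on `Relation.ReflTransGen`);
* ★ `not_section_double_reglue_of_reachable` / `not_exists_section_double_reglue_of_reachable` — **if the
  cell of `bc₀` is NON-SEPARATING in `𝔾_A`**, i.e. the other branch-cell `bc₁ ≠ bc₀` of the same edge-cell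
  abuts to a vertex-cell `vc₁` reachable from the vertex-cell `vc₀` of `bc₀` by incidences avoiding `bc₀`
  (the loop case `vc₁ = vc₀` included), **then the reglued double `(A ⊔ A)^θ → A` has NO section**: going
  round the closed walk returns the sheet of `vc₀` flipped — the parity contradiction of the memo §9.

* ★ `Hom.exists_sectionE_label_of_reachable` — the CONSUMER: with `Hom.exists_section_double_reglue`
  (abc-iut-w4-d080, p501533: if the tautological section of a GLOBAL covering `φ : 𝒢′ → 𝒢` w.r.t. `A`
  AVOIDS the cell `Q` at every branch of `𝒢′` over `b₀`, the reglued double has a section) — **every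
  non-separating edge-cell of `𝔾_A` is an edge section label**: some branch `b′` of `𝒢′` over `b₀` has the
  constituent `s_{e(b′)}` of the tautological section factoring through `φ^*(Q)` (labels of abc-iut-f-161's
  `TieLabels`, `existsUnique_component_sectionE_factors` / `sectionE_factors_reindex`).  This is the CORE
  LEMMA of the class route, NON-SEPARATING half (memo §3/§9); the separating-essential half (R5f, port swap),
  mass balance (R6) and hair (R7) remain.

Pure combinatorics over the landed sheet lemmas plus the engine; it changes no FACT-LIST label (F-1487 stays
open-as-typed, L3-lead δ22; the class route books as CLASS CLOSER only when complete).  Nothing here takes a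
side on [IUTchIII] Cor. 3.12.
-/

namespace Literature.AnabelianGeometry.SemiGraphs

open CategoryTheory CategoryTheory.Limits CategoryTheory.PreGaloisCategory

-- objects occur under several definitionally equal presentations; let unification see through them.
set_option backward.isDefEq.respectTransparency false

universe v₁ u₁ u

namespace SemiGraphOfAnabelioids

namespace BObj

variable {𝒢 : SemiGraphOfAnabelioids.{v₁, u₁, u}} (A : 𝒢.BObj)

/-! ### Bookkeeping on the cells of `𝔾_A` -/

/-- A branch-cell `(b, Q)` of `𝔾_A` is determined by its branch `b` and its component `Q ⊆ T_{e(b)}`.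
[cite: MochizukiSemiAnbd2006, Def. 2.2(i) p.23] -/
theorem eq_of_branchMap_eq_of_heq_brComp {bc bc' : A.fibreData.total.Branch}
    (hb : A.fibreData.proj.branchMap bc = A.fibreData.proj.branchMap bc')
    (hQ : HEq (A.brComp bc) (A.brComp bc')) : bc = bc' := by
  obtain ⟨b, c⟩ := bc
  obtain ⟨b', c'⟩ := bc'
  change b = b' at hb
  subst hb
  have h : (equivShrink (π₀Obj (A.T (𝒢.graph.edgeOf b)))).symm c =
      (equivShrink (π₀Obj (A.T (𝒢.graph.edgeOf b)))).symm c' := eq_of_heq hQ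
  rw [(equivShrink _).symm.injective h]

variable (bc₀ : A.fibreData.total.Branch)

/-! ### Transfer and flip, in the language of `𝔾_A` -/

/-- **Transfer along an incidence of `𝔾_A` other than `bc₀`.**  For a section `σ` of the double reglued by
the detection twist of the cell `bc₀ = (b₀, Q)` and a branch-cell `bc ≠ bc₀` abutting to the vertex-cell
`vc`: the component of `vc` lies in the first sheet iff the component of the edge-cell of `bc` does.
[cite: MochizukiSemiAnbd2006, Cor. 2.7(i) p.30] -/
theorem sheet_transfer_total
    (σ : A ⟶ A.double.reglue (A.doubleTwist (A.fibreData.proj.branchMap bc₀) (A.brComp bc₀)))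
    (hσ : σ ≫ BObj.Hom.reglue A.codiag (A.doubleTwist (A.fibreData.proj.branchMap bc₀) (A.brComp bc₀))
      (A.doubleTwist_codiag (A.fibreData.proj.branchMap bc₀) (A.brComp bc₀)) = 𝟙 A)
    {bc : A.fibreData.total.Branch} {vc : A.fibreData.total.Vertex}
    (h : A.fibreData.total.abuts bc = some vc) (hne : bc ≠ bc₀) :
    ((A.vComp vc).1.arrow ≫ σ.fS (A.fibreData.proj.vertexMap vc) = (A.vComp vc).1.arrow ≫ coprod.inl ↔
      (A.eComp (A.fibreData.total.edgeOf bc)).1.arrow ≫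
          σ.fT (A.fibreData.proj.edgeMap (A.fibreData.total.edgeOf bc)) =
        (A.eComp (A.fibreData.total.edgeOf bc)).1.arrow ≫ coprod.inl) :=
  A.sheet_transfer (A.fibreData.proj.branchMap bc₀) (A.brComp bc₀) σ hσ (A.fibreData.proj.branchMap bc)
    (A.fibreData.proj.vertexMap vc) (abuts_fst h) (A.brComp bc) (A.vComp vc) (brComp_le_branchImage h)
    (fun hb hQ => hne (A.eq_of_branchMap_eq_of_heq_brComp hb hQ))

/-- **Flip along `bc₀`.**  If `bc₀` abuts to the vertex-cell `vc₀`, the component of `vc₀` lies in the first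
sheet iff the component `Q` of the edge-cell of `bc₀` does NOT. [cite: MochizukiSemiAnbd2006, Cor. 2.7(i) p.30] -/
theorem sheet_flip_total
    (σ : A ⟶ A.double.reglue (A.doubleTwist (A.fibreData.proj.branchMap bc₀) (A.brComp bc₀)))
    (hσ : σ ≫ BObj.Hom.reglue A.codiag (A.doubleTwist (A.fibreData.proj.branchMap bc₀) (A.brComp bc₀))
      (A.doubleTwist_codiag (A.fibreData.proj.branchMap bc₀) (A.brComp bc₀)) = 𝟙 A)
    {vc₀ : A.fibreData.total.Vertex} (h₀ : A.fibreData.total.abuts bc₀ = some vc₀) :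
    ((A.vComp vc₀).1.arrow ≫ σ.fS (A.fibreData.proj.vertexMap vc₀) = (A.vComp vc₀).1.arrow ≫ coprod.inl ↔
      ¬ ((A.eComp (A.fibreData.total.edgeOf bc₀)).1.arrow ≫
            σ.fT (A.fibreData.proj.edgeMap (A.fibreData.total.edgeOf bc₀)) =
          (A.eComp (A.fibreData.total.edgeOf bc₀)).1.arrow ≫ coprod.inl)) := by
  have hflip := A.sheet_flip (A.fibreData.proj.branchMap bc₀) (A.brComp bc₀) σ hσ
    (A.fibreData.proj.vertexMap vc₀) (abuts_fst h₀) (A.vComp vc₀) (brComp_le_branchImage h₀)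
  refine hflip.trans ⟨fun hinr hinl => ?_, fun hninl => ?_⟩
  · exact A.sheet_exclusive_T _ σ _ (A.brComp bc₀) hinl hinr
  · rcases A.sheet_dichotomy_T _ (A.doubleTwist_codiag (A.fibreData.proj.branchMap bc₀) (A.brComp bc₀))
      σ hσ _ (A.brComp bc₀) with hinl | hinr
    · exact (hninl hinl).elim
    · exact hinr

/-! ### Walks avoiding `bc₀` -/

/-- **The vertex sheet is constant along chains of incidences of `𝔾_A` avoiding `bc₀`.**  The chain
relation: `vc ⇝ vc′` when some edge-cell has branch-cells `bc, bc′ ≠ bc₀` abutting to `vc` and `vc′`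
(reflexive-transitive closure). [cite: MochizukiSemiAnbd2006, Cor. 2.7(i) p.30] -/
theorem sheetS_iff_of_reflTransGen
    (σ : A ⟶ A.double.reglue (A.doubleTwist (A.fibreData.proj.branchMap bc₀) (A.brComp bc₀)))
    (hσ : σ ≫ BObj.Hom.reglue A.codiag (A.doubleTwist (A.fibreData.proj.branchMap bc₀) (A.brComp bc₀))
      (A.doubleTwist_codiag (A.fibreData.proj.branchMap bc₀) (A.brComp bc₀)) = 𝟙 A)
    {vc vc' : A.fibreData.total.Vertex}
    (hch : Relation.ReflTransGen
      (fun x y : A.fibreData.total.Vertex => ∃ bc bc' : A.fibreData.total.Branch,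
        bc ≠ bc₀ ∧ bc' ≠ bc₀ ∧ A.fibreData.total.edgeOf bc = A.fibreData.total.edgeOf bc' ∧
          A.fibreData.total.abuts bc = some x ∧ A.fibreData.total.abuts bc' = some y) vc vc') :
    ((A.vComp vc).1.arrow ≫ σ.fS (A.fibreData.proj.vertexMap vc) = (A.vComp vc).1.arrow ≫ coprod.inl ↔
      (A.vComp vc').1.arrow ≫ σ.fS (A.fibreData.proj.vertexMap vc') =
        (A.vComp vc').1.arrow ≫ coprod.inl) := by
  induction hch with
  | refl => exact Iff.rfl
  | tail _ hstep ih =>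
    obtain ⟨bc, bc', hne, hne', he, hb, hb'⟩ := hstep
    refine ih.trans ((A.sheet_transfer_total bc₀ σ hσ hb hne).trans ?_)
    rw [he]
    exact (A.sheet_transfer_total bc₀ σ hσ hb' hne').symm

/-! ### No section across a non-separating cell -/

/-- **No section across a non-separating cell** ([SemiAnbd] p. 30, two-sheet parity): let `bc₀` abut to
`vc₀`, let `bc₁ ≠ bc₀` be a branch-cell of the SAME edge-cell abutting to `vc₁`, and let `vc₁` be reachable
from `vc₀` by incidences of `𝔾_A` avoiding `bc₀`.  Then a section `σ` of the double reglued by the detection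
twist of `bc₀` is contradictory: transfer gives `sheet vc₀ = sheet vc₁ = sheet (cell of bc₀)`, the flip gives
`sheet vc₀ ≠ sheet (cell of bc₀)`. [cite: MochizukiSemiAnbd2006, Cor. 2.7(i) p.30] -/
theorem not_section_double_reglue_of_reachable
    {vc₀ vc₁ : A.fibreData.total.Vertex} {bc₁ : A.fibreData.total.Branch}
    (h₀ : A.fibreData.total.abuts bc₀ = some vc₀) (h₁ : A.fibreData.total.abuts bc₁ = some vc₁)
    (hne : bc₁ ≠ bc₀) (he : A.fibreData.total.edgeOf bc₁ = A.fibreData.total.edgeOf bc₀)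
    (hreach : Relation.ReflTransGen
      (fun x y : A.fibreData.total.Vertex => ∃ bc bc' : A.fibreData.total.Branch,
        bc ≠ bc₀ ∧ bc' ≠ bc₀ ∧ A.fibreData.total.edgeOf bc = A.fibreData.total.edgeOf bc' ∧
          A.fibreData.total.abuts bc = some x ∧ A.fibreData.total.abuts bc' = some y) vc₀ vc₁)
    (σ : A ⟶ A.double.reglue (A.doubleTwist (A.fibreData.proj.branchMap bc₀) (A.brComp bc₀)))
    (hσ : σ ≫ BObj.Hom.reglue A.codiag (A.doubleTwist (A.fibreData.proj.branchMap bc₀) (A.brComp bc₀))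
      (A.doubleTwist_codiag (A.fibreData.proj.branchMap bc₀) (A.brComp bc₀)) = 𝟙 A) :
    False := by
  have hchain := A.sheetS_iff_of_reflTransGen bc₀ σ hσ hreach
  have htrans := A.sheet_transfer_total bc₀ σ hσ h₁ hne
  rw [he] at htrans
  have hflip := A.sheet_flip_total bc₀ σ hσ h₀
  exact not_iff_self (hflip.symm.trans (hchain.trans htrans))

/-- **No section across a non-separating cell**, `¬ ∃` form (the shape consumed against
`Hom.exists_section_double_reglue`). [cite: MochizukiSemiAnbd2006, Cor. 2.7(i) p.30] -/
theorem not_exists_section_double_reglue_of_reachable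
    {vc₀ vc₁ : A.fibreData.total.Vertex} {bc₁ : A.fibreData.total.Branch}
    (h₀ : A.fibreData.total.abuts bc₀ = some vc₀) (h₁ : A.fibreData.total.abuts bc₁ = some vc₁)
    (hne : bc₁ ≠ bc₀) (he : A.fibreData.total.edgeOf bc₁ = A.fibreData.total.edgeOf bc₀)
    (hreach : Relation.ReflTransGen
      (fun x y : A.fibreData.total.Vertex => ∃ bc bc' : A.fibreData.total.Branch,
        bc ≠ bc₀ ∧ bc' ≠ bc₀ ∧ A.fibreData.total.edgeOf bc = A.fibreData.total.edgeOf bc' ∧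
          A.fibreData.total.abuts bc = some x ∧ A.fibreData.total.abuts bc' = some y) vc₀ vc₁) :
    ¬ ∃ σ : A ⟶ A.double.reglue (A.doubleTwist (A.fibreData.proj.branchMap bc₀) (A.brComp bc₀)),
      σ ≫ BObj.Hom.reglue A.codiag (A.doubleTwist (A.fibreData.proj.branchMap bc₀) (A.brComp bc₀))
        (A.doubleTwist_codiag (A.fibreData.proj.branchMap bc₀) (A.brComp bc₀)) = 𝟙 A :=
  fun ⟨σ, hσ⟩ => A.not_section_double_reglue_of_reachable bc₀ h₀ h₁ hne he hreach σ hσ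

/-- **The loop case**: if both branch-cells `bc₀ ≠ bc₁` of one edge-cell abut to the SAME vertex-cell, the
reglued double has no section (reachability is reflexive). [cite: MochizukiSemiAnbd2006, Cor. 2.7(i) p.30] -/
theorem not_exists_section_double_reglue_of_loop
    {vc₀ : A.fibreData.total.Vertex} {bc₁ : A.fibreData.total.Branch}
    (h₀ : A.fibreData.total.abuts bc₀ = some vc₀) (h₁ : A.fibreData.total.abuts bc₁ = some vc₀)
    (hne : bc₁ ≠ bc₀) (he : A.fibreData.total.edgeOf bc₁ = A.fibreData.total.edgeOf bc₀) :
    ¬ ∃ σ : A ⟶ A.double.reglue (A.doubleTwist (A.fibreData.proj.branchMap bc₀) (A.brComp bc₀)),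
      σ ≫ BObj.Hom.reglue A.codiag (A.doubleTwist (A.fibreData.proj.branchMap bc₀) (A.brComp bc₀))
        (A.doubleTwist_codiag (A.fibreData.proj.branchMap bc₀) (A.brComp bc₀)) = 𝟙 A :=
  A.not_exists_section_double_reglue_of_reachable bc₀ h₀ h₁ hne he Relation.ReflTransGen.refl

end BObj

/-! ### Consumer: non-separating edge-cells are edge section labels (CORE LEMMA, non-separating half) -/

namespace Hom

variable {𝒢 𝒢' : SemiGraphOfAnabelioids.{v₁, u₁, u}} (φ : Hom 𝒢' 𝒢) {A : 𝒢.BObj} [HasBinaryProducts 𝒢.BObj]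
  (α : Over A ⥤ 𝒢'.BObj) [α.IsEquivalence] (eB : φ.pullbackFunctor ≅ Over.star A ⋙ α)
  (bc₀ : A.fibreData.total.Branch)

/-- **Non-separating edge-cells of `𝔾_A` are edge section labels** ([SemiAnbd] Def. 2.2 (i) p. 23 / proof of
Cor. 2.7 (i) p. 30; abc-iut-w4-d080's CORE LEMMA, non-separating half, GAP G-w4d080-g7-1).  Let `φ : 𝒢′ → 𝒢`
carry the GLOBAL clause `(α, e_B)` w.r.t. `A` (`Hom.IsGlobalCoveringOf` data) and let the branch-cell
`bc₀ = (b₀, Q)` of `𝔾_A` be NON-SEPARATING (the other branch-cell `bc₁` of its edge-cell abuts to a vertex-cell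
reachable from that of `bc₀` by incidences avoiding `bc₀`).  Then some branch `b′` of `𝒢′` over `b₀`
(abutting to a vertex) has edge `e′ = e(b′)` whose EDGE SECTION LABEL is `Q`: the constituent `s_{e′}` of the
tautological section `s = α(η_{𝟙_A}) ≫ e_B⁻¹_A` factors through `φ_{e′}^*(Q ↪ A_{e(b₀)})` (re-indexed to the
edge of `φ b′`).  Proof: otherwise the section AVOIDS `Q` over `b₀`, so the double reglued by the detection
twist of `bc₀` has a section (`Hom.exists_section_double_reglue`, the regluing-invisibility engine), which
`BObj.not_exists_section_double_reglue_of_reachable` forbids. [cite: MochizukiSemiAnbd2006, Cor. 2.7(i) p.30] -/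
theorem exists_sectionE_label_of_reachable
    {vc₀ vc₁ : A.fibreData.total.Vertex} {bc₁ : A.fibreData.total.Branch}
    (h₀ : A.fibreData.total.abuts bc₀ = some vc₀) (h₁ : A.fibreData.total.abuts bc₁ = some vc₁)
    (hne : bc₁ ≠ bc₀) (he : A.fibreData.total.edgeOf bc₁ = A.fibreData.total.edgeOf bc₀)
    (hreach : Relation.ReflTransGen
      (fun x y : A.fibreData.total.Vertex => ∃ bc bc' : A.fibreData.total.Branch,
        bc ≠ bc₀ ∧ bc' ≠ bc₀ ∧ A.fibreData.total.edgeOf bc = A.fibreData.total.edgeOf bc' ∧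
          A.fibreData.total.abuts bc = some x ∧ A.fibreData.total.abuts bc' = some y) vc₀ vc₁) :
    ∃ (b' : 𝒢'.graph.Branch) (v' : 𝒢'.graph.Vertex) (_ : 𝒢'.graph.abuts b' = some v')
      (_ : φ.base.branchMap b' = A.fibreData.proj.branchMap bc₀)
      (P : {P : Subobject (A.T (𝒢.graph.edgeOf (φ.base.branchMap b'))) //
        PreGaloisCategory.IsConnected (P : 𝒢.E (𝒢.graph.edgeOf (φ.base.branchMap b')))}),
      HEq P (A.brComp bc₀) ∧
        ∃ t : (α.obj (Over.mk (𝟙 A))).T (𝒢'.graph.edgeOf b') ⟶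
            (φ.φE (𝒢'.graph.edgeOf b') (𝒢.graph.edgeOf (φ.base.branchMap b'))
              (φ.base.edgeOf_branchMap b').symm).pullback.obj (P.1 : 𝒢.E _),
          t ≫ (φ.φE (𝒢'.graph.edgeOf b') (𝒢.graph.edgeOf (φ.base.branchMap b'))
                (φ.base.edgeOf_branchMap b').symm).pullback.map P.1.arrow ≫
              (φ.reindexIso (𝒢'.graph.edgeOf b') _ _ (φ.base.edgeOf_branchMap b').symm rfl).hom.app A =
            (φ.globalSection α eB).fT (𝒢'.graph.edgeOf b') := by
  by_contra hcon
  refine A.not_exists_section_double_reglue_of_reachable bc₀ h₀ h₁ hne he hreach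
    (φ.exists_section_double_reglue α eB (A.fibreData.proj.branchMap bc₀) (A.brComp bc₀) ?_)
  intro b' v' h' p
  -- the edge label of `e′ = e(b′)` (abc-iut-f-161 `TieLabels`), re-indexed to the edge of `φ b′`
  obtain ⟨P₀, hP₀, -⟩ := φ.existsUnique_component_sectionE_factors A α eB (𝒢'.graph.edgeOf b')
  obtain ⟨k, hk⟩ := φ.sectionE_factors_reindex A α eB (𝒢'.graph.edgeOf b')
    (𝒢.graph.edgeOf (φ.base.branchMap b')) (φ.base.edgeOf_branchMap b').symm P₀ hP₀
  have hk' : k ≫ (φ.φE (𝒢'.graph.edgeOf b') (𝒢.graph.edgeOf (φ.base.branchMap b'))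
        (φ.base.edgeOf_branchMap b').symm).pullback.map
        ((φ.base.edgeOf_branchMap b').symm ▸ P₀ :
          π₀Obj (A.T (𝒢.graph.edgeOf (φ.base.branchMap b')))).1.arrow ≫
      (φ.reindexIso (𝒢'.graph.edgeOf b') _ _ (φ.base.edgeOf_branchMap b').symm rfl).hom.app A =
      (φ.globalSection α eB).fT (𝒢'.graph.edgeOf b') := by
    rw [← Category.assoc, hk, Category.assoc, Hom.reindexIso_hom_app_eq_inv_app, Iso.inv_hom_id_app]
    exact Category.comp_id _
  refine ⟨(φ.base.edgeOf_branchMap b').symm ▸ P₀, fun hheq => hcon ?_, k, hk'⟩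
  exact ⟨b', v', h', p, _, hheq, k, hk'⟩

end Hom

end SemiGraphOfAnabelioids

end Literature.AnabelianGeometry.SemiGraphs
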